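import Literature.AnabelianGeometry.EtaleTheta.TemperedFrobenioidProps
import Literature.AnabelianGeometry.SemiGraphs.CosetCategoriesSlimTempered
import Literature.AnabelianGeometry.SemiGraphs.CosetCategoriesFSM
import Literature.AlgebraicGeometry.Frobenioids.QuasiTemperoidConnectedPart
import HarnessLib

/-!
# [EtTh] Remark 3.7.2 at the genuine base `D₀ = B^temp(X^log)⁰`: "`D₀` is slim and of FSM-, hence FSMFF-, type" — PROVED

S. Mochizuki, *The étale theta function and its Frobenioid-theoretic manifestations*, Publ. RIMS **45** (2009)
[MochizukiEtTh2009], Remark 3.7.2, printed p. 306 (kurims ms p. 73; FACT-LIST locator "Rmk 3.7.2 p.80")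
[cite: MochizukiEtTh2009, Rmk 3.7.2 p.80]: «We recall in passing that `D₀` is slim [cf. [SemiAnbd], Example 3.10;
[SemiAnbd], Remark 3.4.1] and of FSM-, hence also of FSMFF-, type [cf. [FrdII], Example 1.3, (i)].»  Here
`D₀ := B^temp(X^log)⁰ ≅ B^temp(Π^tp_X)⁰` (§3, kurims p. 65: «the superscript "0" denotes the full subcategory
constituted by the connected objects»).

PROOF-ONLY companion (no definitions, no instances) of abc-iut-L2-t3's statements file `TemperedFrobenioidProps.lean`;
abc-iut cell, block F (fact-proving wave), seat abc-iut-f-138, FACT-LIST row **F-1397** `TemperedFrobenioid.Remark372`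
(class `preparatory`, `parametrised`; universal closure over an ARBITRARY category `D₀` REFUTED by abc-iut-f-049,
`TemperedFrobenioid.not_forall_remark372` at `D₀ = B(ℤ)`, `TemperedFrobenioidPropsSchemaNegative.lean`).  This file proves
the INSTANCE FORMS the print makes, i.e. `Remark372 D₀` at the connected temperoid of a tempered, temp-slim group and at
the tree's [SemiAnbd] Ex. 3.10 data, by assembling three theorems already in the tree BY NAME:

* slimness — `SemiGraphs.isSlim_connectedPart_bTemp` / `SemiGraphs.CosetCat.isSlim_of_isSlimGroup_of_isTempered`
  (abc-iut-L2-d4, `CosetCategoriesSlimTempered.lean`: [SemiAnbd] Rmk. 3.4.1 "a temperoid is slim iff it is temp-slim",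
  [FrdI] §0 p. 14), with temp-slimness of `Π^tp_X` = [SemiAnbd] Ex. 3.10 (field `TemperedArithmeticGroup.isSlimGroup`);
* FSM-type and FSMFF-type — `Frobenioids.QuasiTemperoid.BTempConnected.connectedPart_isOfFSMType` /
  `connectedPart_isOfFSMFFType` (`QuasiTemperoidConnectedPart.lean`) and `SemiGraphs.CosetCat.isOfFSMType` /
  `isOfFSMFFType` (`CosetCategoriesFSM.lean`): [FrdII] Ex. 1.3 (i) "every monomorphism of `E⁰` is an isomorphism".

Results: `remark372_connectedPart_bTemp` (`Π` tempered + temp-slim ⇒ `Remark372 (ConnectedPart (BTemp Π))`),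
`remark372_cosetCat` (same on the small coset model `CosetCat Π ≌ B^temp(Π)⁰`), and the unconditional
`TemperedArithmeticGroup.remark372_holds` at `D₀ := ConnectedPart (BTemp X.Pi)` for `X : TemperedArithmeticGroup K`
— the base over which the cone's genuine [EtTh] §4–§5 settings live (`BiKummerSetting.mkOfConnectedTemperoid`,
`Discharge/Sec5OfConnectedTemperoid.lean`), so the hypothesis `h372 : Remark372 D₀` of `BiKummerThm44Sub*.lean` is
discharged there BY NAME.  HONEST FRAMING: refereed pre-IUT material ([SemiAnbd] 2006, [FrdI]/[FrdII] 2008, [EtTh] 2009);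
nothing here bears on [IUTchIII] Cor. 3.12; a FACT row is an assumption label, "proved" = this kernel check only.
-/

namespace Literature.AnabelianGeometry.EtaleTheta

open CategoryTheory Literature.AlgebraicGeometry.Frobenioids Literature.AnabelianGeometry.SemiGraphs

universe u

namespace TemperedFrobenioid

variable {G : Type u} [Group G] [TopologicalSpace G] [IsTopologicalGroup G]

/-- **Remark 3.7.2 at `D₀ = B^temp(Π)⁰` for a tempered, temp-slim group `Π`**: `ConnectedPart (BTemp Π)` is slim
([SemiAnbd] Rmk. 3.4.1 / Ex. 3.10) and of FSM-, hence FSMFF-, type ([FrdII] Ex. 1.3 (i)).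
[cite: MochizukiEtTh2009, Rmk 3.7.2 p.80] -/
theorem remark372_connectedPart_bTemp (hG : IsTempered G) (hZ : IsSlimGroup G) :
    Literature.AnabelianGeometry.EtaleTheta.TemperedFrobenioid.Remark372 (ConnectedPart (BTemp G)) :=
  ⟨isSlim_connectedPart_bTemp hG hZ, QuasiTemperoid.BTempConnected.connectedPart_isOfFSMType,
    QuasiTemperoid.BTempConnected.connectedPart_isOfFSMFFType⟩

/-- **Remark 3.7.2 on the small coset model `CosetCat Π`** (`≌ B^temp(Π)⁰`, abc-iut-L5-t2's `CosetCat.equivConnectedPart`)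
for a tempered, temp-slim group `Π`: slim and of FSM-, hence FSMFF-, type. [cite: MochizukiEtTh2009, Rmk 3.7.2 p.80] -/
theorem remark372_cosetCat (hG : IsTempered G) (hZ : IsSlimGroup G) :
    Literature.AnabelianGeometry.EtaleTheta.TemperedFrobenioid.Remark372 (CosetCat G) :=
  ⟨CosetCat.isSlim_of_isSlimGroup_of_isTempered hG hZ, CosetCat.isOfFSMType, CosetCat.isOfFSMFFType⟩

end TemperedFrobenioid

/-- **Remark 3.7.2 as printed** — at `D₀ := B^temp(X^log)⁰ = ConnectedPart (BTemp Π^tp_X)` for the tree's [SemiAnbd]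
Ex. 3.10 interface `X : TemperedArithmeticGroup K` (`Π^tp_X` tempered and temp-slim): «`D₀` is slim … and of FSM-, hence
also of FSMFF-, type».  Unconditional; this is FACT-LIST row F-1397 at the genuine instance (its universal closure over
arbitrary categories being false, `TemperedFrobenioid.not_forall_remark372`). [cite: MochizukiEtTh2009, Rmk 3.7.2 p.80] -/
theorem _root_.Literature.AnabelianGeometry.SemiGraphs.TemperedArithmeticGroup.remark372_holds {K : Type u} [Field K]
    (X : TemperedArithmeticGroup K) :
    Literature.AnabelianGeometry.EtaleTheta.TemperedFrobenioid.Remark372 (ConnectedPart (BTemp X.Pi)) :=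
  TemperedFrobenioid.remark372_connectedPart_bTemp X.isTempered X.isSlimGroup

end Literature.AnabelianGeometry.EtaleTheta
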